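import Mathlib
import HarnessLib

/-!
# The circle product of polymer functionals (Brydges' polymer algebra)

For functionals on polymers — maps `F : Finset α → R` on the finite subsets of a set `α` of blocks,
with values in a commutative ring `R` (in the application: functions of the field) — the CIRCLE
PRODUCT is `(F ∘ G)(X) = Σ_{Y ⊆ X} F(Y) G(X ∖ Y)`.  It is commutative and associative with unit
`𝟙_∅` (`X ↦ [X = ∅]`); the renormalisation-group representations `Z = ∫ (e^{−H} ∘ K)(Λ) dμ` of
Adams–Kotecký–Müller / Brydges–Slade are built on it.  Purely combinatorial; proved here in full.

## References
* S. Adams, R. Kotecký, S. Müller, arXiv:1606.09541, Ch. 4 (the product `(F ∘ G)(X,φ) =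
  Σ_{Y ∈ 𝓟_k(X)} F(Y,φ) G(X∖Y,φ)` on `M(𝓟_k, 𝓧)`) [AdamsKoteckyMuller2016].
* D. Brydges, *Lectures on the renormalisation group* (Park City), Sec. 2 (polymer expansions and the
  circle product) [Brydges2009LecturesRG].
-/

namespace Literature.MathematicalPhysics.StatisticalMechanics.PolymerAlgebra

open scoped BigOperators
open Finset

variable {α : Type*} [DecidableEq α] {R : Type*} [CommRing R]

/-- The circle product `(F ∘ G)(X) = Σ_{Y ⊆ X} F(Y) · G(X ∖ Y)` of two polymer functionals.
[cite: AdamsKoteckyMuller2016, Ch. 4] -/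
def circ (F G : Finset α → R) : Finset α → R :=
  fun X => ∑ Y ∈ X.powerset, F Y * G (X \ Y)

/-- The unit `𝟙_∅`: `1` on the empty polymer, `0` otherwise. [cite: AdamsKoteckyMuller2016, Ch. 4] -/
def one : Finset α → R := fun X => if X = ∅ then 1 else 0

/-- `(F ∘ G)(X) = Σ_{Y ⊆ X} F(X ∖ Y) G(Y)` (reflect `Y ↦ X ∖ Y`). [cite: AdamsKoteckyMuller2016, Ch. 4] -/
theorem circ_apply_symm (F G : Finset α → R) (X : Finset α) :
    circ F G X = ∑ Y ∈ X.powerset, F (X \ Y) * G Y := by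
  unfold circ
  refine Finset.sum_nbij' (fun Y => X \ Y) (fun Y => X \ Y) ?_ ?_ ?_ ?_ ?_
  · intro Y hY; exact mem_powerset.mpr sdiff_subset
  · intro Y hY; exact mem_powerset.mpr sdiff_subset
  · intro Y hY; rw [mem_powerset] at hY; exact Finset.sdiff_sdiff_eq_self hY
  · intro Y hY; rw [mem_powerset] at hY; exact Finset.sdiff_sdiff_eq_self hY
  · intro Y hY; rw [mem_powerset] at hY; rw [Finset.sdiff_sdiff_eq_self hY]

/-- **Commutativity** of the circle product. [cite: AdamsKoteckyMuller2016, Ch. 4] -/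
theorem circ_comm (F G : Finset α → R) : circ F G = circ G F := by
  funext X
  rw [circ_apply_symm]
  unfold circ
  exact Finset.sum_congr rfl (fun Y _ => mul_comm _ _)

/-- `𝟙_∅` is a left unit. [cite: AdamsKoteckyMuller2016, Ch. 4] -/
theorem one_circ (F : Finset α → R) : circ one F = F := by
  funext X
  unfold circ one
  rw [Finset.sum_eq_single ∅]
  · simp
  · intro Y _ hY
    simp [hY]
  · intro h
    exact absurd (empty_mem_powerset X) h

/-- `𝟙_∅` is a right unit. [cite: AdamsKoteckyMuller2016, Ch. 4] -/
theorem circ_one (F : Finset α → R) : circ F one = F := by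
  rw [circ_comm]; exact one_circ F

/-- **Associativity** of the circle product: both sides equal the sum over ordered decompositions
`X = Y₁ ⊔ Y₂ ⊔ Y₃` of `F(Y₁) G(Y₂) H(Y₃)`. [cite: AdamsKoteckyMuller2016, Ch. 4] -/
theorem circ_assoc (F G H : Finset α → R) : circ (circ F G) H = circ F (circ G H) := by
  funext X
  -- both sides as a double sum over the sigma type `Σ Y ⊆ X, (subsets of the complementary piece)`
  have lhs : circ (circ F G) H X
      = ∑ p ∈ X.powerset.sigma (fun Y => Y.powerset), F p.2 * G (p.1 \ p.2) * H (X \ p.1) := by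
    unfold circ
    rw [Finset.sum_sigma]
    refine Finset.sum_congr rfl (fun Y _ => ?_)
    rw [Finset.sum_mul]
  have rhs : circ F (circ G H) X
      = ∑ p ∈ X.powerset.sigma (fun Z => (X \ Z).powerset), F p.1 * G p.2 * H ((X \ p.1) \ p.2) := by
    unfold circ
    rw [Finset.sum_sigma]
    refine Finset.sum_congr rfl (fun Z _ => ?_)
    rw [Finset.mul_sum]
    refine Finset.sum_congr rfl (fun W _ => ?_)
    ring
  rw [lhs, rhs]
  -- bijection `(Y, Z) ↦ (Z, Y \ Z)` with inverse `(Z, W) ↦ (Z ∪ W, Z)`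
  refine Finset.sum_nbij' (fun p => ⟨p.2, p.1 \ p.2⟩) (fun q => ⟨q.1 ∪ q.2, q.1⟩) ?_ ?_ ?_ ?_ ?_
  · rintro ⟨Y, Z⟩ h
    simp only [mem_sigma, mem_powerset] at h ⊢
    exact ⟨h.2.trans h.1, sdiff_subset_sdiff h.1 le_rfl⟩
  · rintro ⟨Z, W⟩ h
    simp only [mem_sigma, mem_powerset] at h ⊢
    exact ⟨union_subset h.1 (h.2.trans sdiff_subset), subset_union_left⟩
  · rintro ⟨Y, Z⟩ h
    simp only [mem_sigma, mem_powerset] at h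
    simp only [union_sdiff_of_subset h.2]
  · rintro ⟨Z, W⟩ h
    simp only [mem_sigma, mem_powerset] at h ⊢
    have hdis : Disjoint Z W := disjoint_of_subset_right h.2 disjoint_sdiff
    simp only [union_sdiff_left, hdis.symm.sdiff_eq_left]
  · rintro ⟨Y, Z⟩ h
    simp only [mem_sigma, mem_powerset] at h
    have hYZ : Z ⊔ Y \ Z = Y := by
      rw [Finset.sup_eq_union, Finset.union_sdiff_of_subset h.2]
    simp only [sdiff_sdiff_left, hYZ]


/-! ## Multiplicative functionals and the binomial expansion over blocks
The starting point of every renormalisation-group representation: a product over blocks of a sum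
`∏_{B ∈ X} (f(B) + g(B))` is the circle product of the multiplicative functionals `f^X = ∏_{B∈X} f(B)`
and `g^X` — e.g. `∏_x (1 + K(∇φ(x))) = (1^∘ ∘ K^∘)(Λ)` for a single-site perturbation `K`. -/

/-- The multiplicative ("block-factorised") functional `f^X = ∏_{B ∈ X} f(B)` of a one-block
functional `f`. [cite: AdamsKoteckyMuller2016, Ch. 4] -/
def blockProd (f : α → R) : Finset α → R := fun X => ∏ b ∈ X, f b

omit [DecidableEq α] in
/-- `f^∅ = 1`. [cite: AdamsKoteckyMuller2016, Ch. 4] -/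
theorem blockProd_empty (f : α → R) : blockProd f ∅ = 1 := by
  simp [blockProd]

/-- multiplicativity over disjoint polymers: `f^{X ⊔ Y} = f^X f^Y`. [cite: AdamsKoteckyMuller2016, Ch. 4] -/
theorem blockProd_union {f : α → R} {X Y : Finset α} (h : Disjoint X Y) :
    blockProd f (X ∪ Y) = blockProd f X * blockProd f Y := by
  simp only [blockProd, Finset.prod_union h]

/-- **Binomial expansion over blocks**: `∏_{B∈X} (f(B) + g(B)) = (f^∘ ∘ g^∘)(X) = Σ_{Y⊆X} f^Y g^{X∖Y}`
(the identity that writes `∏_x (1 + K_x)` as a polymer expansion). [cite: Brydges2009LecturesRG, Sec. 2] -/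
theorem circ_blockProd (f g : α → R) (X : Finset α) :
    circ (blockProd f) (blockProd g) X = ∏ b ∈ X, (f b + g b) := by
  unfold circ blockProd
  rw [Finset.prod_add]

/-- In particular `∏_{B∈X} (1 + g(B)) = Σ_{Y ⊆ X} g^Y` (`1^∘ ∘ g^∘` with `1^Y = 1`).
[cite: Brydges2009LecturesRG, Sec. 2] -/
theorem prod_one_add_eq_sum_blockProd (g : α → R) (X : Finset α) :
    ∏ b ∈ X, (1 + g b) = ∑ Y ∈ X.powerset, blockProd g Y := by
  rw [← circ_blockProd (fun _ => (1 : R)) g X, circ_apply_symm]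
  exact Finset.sum_congr rfl (fun Y _ => by simp [blockProd])

end Literature.MathematicalPhysics.StatisticalMechanics.PolymerAlgebra
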